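import Literature.NumberTheory.Transcendental.SixExponentialsPadicProofs
import HarnessLib

/-!
# Bookkeeping of denominators and houses of algebraic numbers built by ring operations, and the `p`-adic Liouville inequality for them

Topic `Literature/NumberTheory/Transcendental` (namespace `Literature.NumberTheory.Transcendental`,
grouping sub-namespace `AlgSize`). Everything here is PROVED; one definition with a body (the
predicate `AlgSize.IsGood`); no named facts.

In every transcendence proof the values of the auxiliary function at the special points are
algebraic numbers `ξ` built from finitely many generators (`αᵢⱼ = e^{xᵢyⱼ}`, algebraic
coordinates, …) by sums and products with integer coefficients, and the Liouville step needs two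
sizes of `ξ`: a DENOMINATOR (`d^N ξ` is an algebraic integer, `d` a common denominator of the
generators, `N` the total degree of the expression) and a HOUSE (`|σ(d^N ξ)| ≤ B` for every complex
embedding `σ`), cf. [Waldschmidt1988, §6, p. 389] and the tree's `SixExpPadic.liouville_padic` /
`SixExpPadic.exists_den`, which consume exactly these two data. This file isolates the (trivial)
calculus of the predicate

  `IsGood d N B x :⟺ d^N x ∈ 𝓞_k ∧ ∀ σ : k →+* ℂ, ‖σ(d^N x)‖ ≤ B`   (`x` in a number field `k`)

under the ring operations — `0`, `1`, integers, generators (`of_isIntegral_mul`), `+`, `∑`, `*`,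
`∏`, `^`, raising `N`, enlarging `B` — so that the sizes of a complicated expression (a word of
invariant derivations applied to the auxiliary polynomial, evaluated at a point `γ(h)`) are
obtained by structural induction instead of through an explicit universal polynomial; and the
consequence of the `p`-adic Liouville inequality in these terms (`AlgSize.norm_map_ge_of_isGood`):
for `x ≠ 0` good with `(d, N, B)`, `B ≥ 1`, and `τ : k → E` into an ultrametric normed
`ℚ_p`-algebra field, `‖τ x‖ ≥ B^{-[k:ℚ]}`.

## References

* [Waldschmidt1988] M. Waldschmidt, *On the transcendence methods of Gel'fond and Schneider in
  several variables*, New Advances in Transcendence Theory (A. Baker ed.), CUP 1988, 375–398, §6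
  (p. 389).
* M. Waldschmidt, *Diophantine Approximation on Linear Algebraic Groups*, Grundlehren 326,
  Springer 2000, §§3.4–3.5 (denominators, houses, Liouville's inequality).
-/

noncomputable section

open Finset NumberField

namespace Literature.NumberTheory.Transcendental

namespace AlgSize

section Algebra

variable {k : Type*} [Field k] [NumberField k]

/-- **`x` has denominator exponent `≤ N` (for the denominator `d`) and house `≤ B`**:
`d^N x` is an algebraic integer all of whose complex conjugates have absolute value `≤ B`.
[cite: Waldschmidt1988, §6 (p. 389)] -/
def IsGood (d : ℤ) (N : ℕ) (B : ℝ) (x : k) : Prop :=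
  IsIntegral ℤ ((d : k) ^ N * x) ∧ ∀ σ : k →+* ℂ, ‖σ ((d : k) ^ N * x)‖ ≤ B

namespace IsGood

variable {d : ℤ} {N N' : ℕ} {B B' : ℝ} {x y : k}

/-- The house bound is nonnegative (there is at least one complex embedding). [folklore] -/
theorem nonneg (h : IsGood d N B x) : 0 ≤ B := by
  obtain ⟨σ⟩ : Nonempty (k →+* ℂ) := inferInstance
  exact (norm_nonneg _).trans (h.2 σ)

omit [NumberField k] in
/-- Enlarging the house bound. [folklore] -/
theorem mono (h : IsGood d N B x) (hB : B ≤ B') : IsGood d N B' x :=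
  ⟨h.1, fun σ => (h.2 σ).trans hB⟩

omit [NumberField k] in
/-- `0` is good. [folklore] -/
theorem zero (hB : 0 ≤ B) : IsGood d N B (0 : k) :=
  ⟨by rw [mul_zero]; exact isIntegral_zero, fun σ => by simpa using hB⟩

omit [NumberField k] in
/-- The size of an integer under a complex embedding. [folklore] -/
theorem norm_map_intCast (σ : k →+* ℂ) (z : ℤ) : ‖σ (z : k)‖ = |(z : ℝ)| := by
  rw [map_intCast, ← Int.cast_abs, ← Complex.ofReal_intCast, Complex.norm_real, Int.cast_abs,
    Real.norm_eq_abs]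

omit [NumberField k] in
/-- An integer `z` is good with `N = 0`, `B = |z|`. [folklore] -/
theorem intCast (z : ℤ) : IsGood d 0 (|(z : ℝ)|) (z : k) := by
  refine ⟨by rw [pow_zero, one_mul]; exact isIntegral_algebraMap (x := z), fun σ => ?_⟩
  rw [pow_zero, one_mul, norm_map_intCast]

omit [NumberField k] in
/-- A natural number `m` is good with `N = 0`, `B = m`. [folklore] -/
theorem natCast (m : ℕ) : IsGood d 0 (m : ℝ) (m : k) := by
  have := intCast (k := k) (d := d) (m : ℤ)
  rwa [Int.cast_natCast, Int.cast_natCast, Nat.abs_cast] at this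

omit [NumberField k] in
/-- `1` is good. [folklore] -/
theorem one : IsGood d 0 1 (1 : k) := by simpa using natCast (k := k) (d := d) 1

omit [NumberField k] in
/-- **Raising the denominator exponent**: `IsGood d N B x → IsGood d (N + N') (|d|^{N'} B) x`.
[folklore] -/
theorem raise (h : IsGood d N B x) (N' : ℕ) : IsGood d (N + N') ((|(d : ℝ)|) ^ N' * B) x := by
  have e : (d : k) ^ (N + N') * x = (d : k) ^ N' * ((d : k) ^ N * x) := by rw [pow_add]; ring
  refine ⟨?_, fun σ => ?_⟩
  · rw [e]
    exact ((isIntegral_algebraMap (R := ℤ) (A := k) (x := d)).pow N').mul h.1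
  · rw [e, map_mul, norm_mul, map_pow, norm_pow, norm_map_intCast]
    exact mul_le_mul_of_nonneg_left (h.2 σ) (by positivity)

/-- Raising the denominator exponent to a prescribed `N₁ ≥ N` (with the cruder bound `|d|^{N₁} B`,
`d ≠ 0`, `B ≥ 0`). [folklore] -/
theorem raise_to (h : IsGood d N B x) {N₁ : ℕ} (hN : N ≤ N₁) (hd : d ≠ 0) :
    IsGood d N₁ ((|(d : ℝ)|) ^ N₁ * B) x := by
  obtain ⟨N', rfl⟩ : ∃ N', N₁ = N + N' := ⟨N₁ - N, by omega⟩
  refine (h.raise N').mono (mul_le_mul_of_nonneg_right ?_ h.nonneg)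
  have hd1 : (1 : ℝ) ≤ |(d : ℝ)| := by
    rw [← Int.cast_abs]
    exact_mod_cast Int.one_le_abs hd
  exact pow_le_pow_right₀ hd1 (by omega)

/-- **Sums.** [folklore] -/
theorem add (hx : IsGood d N B x) (hy : IsGood d N B' y) : IsGood d N (B + B') (x + y) := by
  refine ⟨?_, fun σ => ?_⟩
  · rw [mul_add]
    exact hx.1.add hy.1
  · rw [mul_add, map_add]
    exact (norm_add_le _ _).trans (add_le_add (hx.2 σ) (hy.2 σ))

/-- **Finite sums.** [folklore] -/
theorem sum {ι : Type*} (t : Finset ι) {f : ι → k} {Bf : ι → ℝ}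
    (h : ∀ i ∈ t, IsGood d N (Bf i) (f i)) : IsGood d N (∑ i ∈ t, Bf i) (∑ i ∈ t, f i) := by
  classical
  induction t using Finset.induction_on with
  | empty => simpa using zero (k := k) (d := d) (N := N) le_rfl
  | insert a t ha ih =>
    rw [Finset.sum_insert ha, Finset.sum_insert ha]
    exact (h a (by simp)).add (ih fun i hi => h i (by simp [hi]))

/-- Finite sums with a uniform bound: `≤ card · B`. [folklore] -/
theorem sum_const {ι : Type*} (t : Finset ι) {f : ι → k}
    (h : ∀ i ∈ t, IsGood d N B (f i)) : IsGood d N (t.card * B) (∑ i ∈ t, f i) := by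
  have := sum t h
  rwa [Finset.sum_const, nsmul_eq_mul] at this

/-- **Products.** [folklore] -/
theorem mul (hx : IsGood d N B x) (hy : IsGood d N' B' y) : IsGood d (N + N') (B * B') (x * y) := by
  have e : (d : k) ^ (N + N') * (x * y) = ((d : k) ^ N * x) * ((d : k) ^ N' * y) := by
    rw [pow_add]; ring
  refine ⟨?_, fun σ => ?_⟩
  · rw [e]
    exact hx.1.mul hy.1
  · rw [e, map_mul, norm_mul]
    exact mul_le_mul (hx.2 σ) (hy.2 σ) (norm_nonneg _) hx.nonneg

/-- **Finite products.** [folklore] -/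
theorem prod {ι : Type*} (t : Finset ι) {f : ι → k} {Nf : ι → ℕ} {Bf : ι → ℝ}
    (h : ∀ i ∈ t, IsGood d (Nf i) (Bf i) (f i)) :
    IsGood d (∑ i ∈ t, Nf i) (∏ i ∈ t, Bf i) (∏ i ∈ t, f i) := by
  classical
  induction t using Finset.induction_on with
  | empty => simpa using one (k := k) (d := d)
  | insert a t ha ih =>
    rw [Finset.sum_insert ha, Finset.prod_insert ha, Finset.prod_insert ha]
    exact (h a (by simp)).mul (ih fun i hi => h i (by simp [hi]))

/-- **Powers.** [folklore] -/
theorem pow (h : IsGood d N B x) (m : ℕ) : IsGood d (m * N) (B ^ m) (x ^ m) := by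
  have := prod (Finset.range m) (f := fun _ => x) (Nf := fun _ => N) (Bf := fun _ => B) fun _ _ => h
  simpa using this

/-- Multiplication by an integer. [folklore] -/
theorem intCast_mul (z : ℤ) (h : IsGood d N B x) : IsGood d N (|(z : ℝ)| * B) ((z : k) * x) := by
  have := (intCast (k := k) (d := d) z).mul h
  rwa [zero_add] at this

/-- Multiplication by a natural number. [folklore] -/
theorem natCast_mul (m : ℕ) (h : IsGood d N B x) : IsGood d N ((m : ℝ) * B) ((m : k) * x) := by
  have := (natCast (k := k) (d := d) m).mul h
  rwa [zero_add] at this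

omit [NumberField k] in
/-- **Generators**: if `d · x` is an algebraic integer and all conjugates of `x` are `≤ C`, then `x`
is good with `N = 1`, `B = |d| C`. [folklore] -/
theorem of_isIntegral_mul (hint : IsIntegral ℤ ((d : k) * x)) {C : ℝ} (hC : ∀ σ : k →+* ℂ, ‖σ x‖ ≤ C) :
    IsGood d 1 (|(d : ℝ)| * C) x := by
  refine ⟨by rwa [pow_one], fun σ => ?_⟩
  rw [pow_one, map_mul, norm_mul, norm_map_intCast]
  exact mul_le_mul_of_nonneg_left (hC σ) (abs_nonneg _)

end IsGood

/-- A common denominator and a common house bound for finitely many elements of a number field.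
[folklore] -/
theorem exists_den_house {k : Type} [Field k] [NumberField k] {ι : Type*} [Fintype ι] (g : ι → k) :
    ∃ (d : ℤ) (C : ℝ), d ≠ 0 ∧ 1 ≤ C ∧ ∀ i, IsGood d 1 (|(d : ℝ)| * C) (g i) := by
  classical
  obtain ⟨d, hd, hint⟩ := SixExpPadic.exists_den g
  let C : ℝ := 1 + ∑ q : ι × (k →+* ℂ), ‖q.2 (g q.1)‖
  have hC : ∀ (i : ι) (σ : k →+* ℂ), ‖σ (g i)‖ ≤ C := by
    intro i σ
    have h1 : ‖σ (g i)‖ ≤ ∑ q : ι × (k →+* ℂ), ‖q.2 (g q.1)‖ :=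
      Finset.single_le_sum (f := fun q : ι × (k →+* ℂ) => ‖q.2 (g q.1)‖) (fun _ _ => norm_nonneg _)
        (Finset.mem_univ (i, σ))
    change ‖σ (g i)‖ ≤ 1 + _
    linarith
  refine ⟨d, C, hd, ?_, fun i => IsGood.of_isIntegral_mul (hint i) (hC i)⟩
  change (1 : ℝ) ≤ 1 + _
  linarith [Finset.sum_nonneg (fun (q : ι × (k →+* ℂ)) (_ : q ∈ Finset.univ) => norm_nonneg (q.2 (g q.1)))]

end Algebra

/-! ### The `p`-adic Liouville inequality for good elements -/

section Liouville

/-- **Liouville's inequality, `p`-adic, for a good element**: if `x ≠ 0` is good with `(d, N, B)`,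
`d ≠ 0`, `B ≥ 1`, then `‖τ x‖ ≥ B^{-[k:ℚ]}` for every `τ : k →+* E` (the algebraic integer
`d^N x` has `‖τ(d^N x)‖ ≥ B^{-[k:ℚ]}` by `SixExpPadic.liouville_padic`, and `‖τ d‖ ≤ 1`).
[cite: Waldschmidt1988, §6 (p. 389)] -/
theorem norm_map_ge_of_isGood (p : ℕ) [Fact p.Prime] {E : Type} [NontriviallyNormedField E]
    [NormedAlgebra ℚ_[p] E] [IsUltrametricDist E] {k : Type} [Field k] [NumberField k] (τ : k →+* E)
    {d : ℤ} {N : ℕ} {B : ℝ} {x : k} (hx : x ≠ 0) (hd : d ≠ 0) (hB : 1 ≤ B) (h : IsGood d N B x) :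
    (B ^ Module.finrank ℚ k)⁻¹ ≤ ‖τ x‖ := by
  let ξ : 𝓞 k := ⟨(d : k) ^ N * x, h.1⟩
  have hξ : ξ ≠ 0 := by
    intro h0
    have : ((ξ : 𝓞 k) : k) = 0 := by rw [h0]; rfl
    change (d : k) ^ N * x = 0 at this
    rcases mul_eq_zero.1 this with h1 | h1
    · exact (pow_ne_zero N (Int.cast_ne_zero.2 hd)) h1
    · exact hx h1
  have hL := SixExpPadic.liouville_padic (ℓ := p) τ hξ hB (fun σ => h.2 σ)
  change (B ^ Module.finrank ℚ k)⁻¹ ≤ ‖τ ((d : k) ^ N * x)‖ at hL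
  rw [map_mul, map_pow, norm_mul, norm_pow, map_intCast] at hL
  refine hL.trans ?_
  refine mul_le_of_le_one_left (norm_nonneg _) ?_
  exact pow_le_one₀ (norm_nonneg _) (PadicExp.norm_intCast_le_one (ℓ := p) d)

end Liouville

end AlgSize

end Literature.NumberTheory.Transcendental
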